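import Summits.Ventures.HodgeRepro.QuadOrbits12C6C2A

/-!
# Degree 12, `C₆ × C₂`: the twist classes of pattern `(3,2,1)` — part B

Blind re-derivation cell `pub-hodge-repro`, seat `typer` (gen 5).  Kernel rows of `QuadOrbits.lean` on
the SEALED table `Duodecic.C6C2.Γ` (`C₆ × C₂`, FaceCensusRows12.lean).  Pattern `(3,2,1)`, continued: coverage of chunks 2 and 3, well-formedness of the representatives (listed, pairwise not twists), and the assembled certificate `classes321_C6C2`: the 960 quadruples of pattern `(3,2,1)` fall into exactly 80 twist classes (ROUTE.md §3.4).
The representatives were computed outside Lean (proofs/typer-g5/quadorbits12.py); every claim about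
them is re-checked here by kernel `decide` (one theorem per 240-quadruple chunk to stay inside the
default heartbeat budget).
-/

set_option autoImplicit false

open Summit.Ventures.HodgeRepro.FaceCensus

namespace HodgeRepro.QuadEngine

/-- Chunk 2 is covered by the representatives. -/
theorem cover321_C6C2_2 : coverChunk Duodecic.C6C2.Γ 3 2 240 2 reps_C6C2_321 = true := by decide +kernel

/-- Chunk 3 is covered by the representatives. -/
theorem cover321_C6C2_3 : coverChunk Duodecic.C6C2.Γ 3 2 240 3 reps_C6C2_321 = true := by decide +kernel

/-- The representatives are listed quadruples and pairwise not twists of each other. -/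
theorem repsWF321_C6C2 : repsWF Duodecic.C6C2.Γ (quadsPat Duodecic.C6C2.Γ 3 2) reps_C6C2_321 = true := by decide +kernel

/-- **`C₆ × C₂`, pattern `(3,2,1)`: 960 quadruples in exactly 80 twist classes** (ROUTE.md §3.4). -/
theorem classes321_C6C2 :
    IsClassReps Duodecic.C6C2.Γ 3 2 reps_C6C2_321 ∧ reps_C6C2_321.length = 80 ∧
      (quadsPat Duodecic.C6C2.Γ 3 2).length = 960 := by
  refine ⟨isClassReps_of_chunks _ 3 2 240 (by norm_num) _ ?_ repsWF321_C6C2, rfl, quads321_C6C2_length⟩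
  intro k hk
  rw [chunks321_C6C2_length] at hk
  match k, hk with
  | 0, _ => exact cover321_C6C2_0
  | 1, _ => exact cover321_C6C2_1
  | 2, _ => exact cover321_C6C2_2
  | 3, _ => exact cover321_C6C2_3
  | _ + 4, h => exact absurd h (by omega)

end HodgeRepro.QuadEngine
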